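import Summits.HodgeConjecture.HodgeConjecture.Theorems.R90S6ConstantTermTransport          -- ★ B2a FILE 1 (this seat): (T.1), (T.2), §4 `integral_prod_coeff_toVector_frame_eq` (any rank `M`)
import Summits.HodgeConjecture.HodgeConjecture.Theorems.R90S6ConstantTermTransportValue     -- ★ B2a FILE 2 (this seat): `measurable_coeff_toVector_comp`, `toReal_div_mul_mul_smul_eq` (the G-side VALUE)
import Literature.NumberTheory.Automorphic.UnitaryGroupTorusOrbitalIntegralCanonicalH       -- ★ `classOrbitalIntegral_prod_eq_smul_integral_prod_of_torus_regular_of_nonsplit` (B-p18 (g32)): the H-side canonical value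
import HarnessLib

/-!
# R90 · S6 «Ch. 14.1–14.5 stable trace formula» — CARD B2a, FILE 3 (row E1.3.6.2): THE H-TWIN — the canonical orbital integral of a Hecke operator of
# `U(2)_w` on `H_v = U(Φ₂)(L⁺_v) × U(Φ₁)(L⁺_v)` at a regular Levi class `⟦(t, u)⟧` through a Borel-compatible frame (`Theorems/R90S6ConstantTermTransportValueH.lean`)

Dealer R90-C14-plan (g2), RULING F5-R1 2026-09-05T01:10:47Z + CARD B2a 01:13:19Z + letter 01:15:59Z + ruling 01:35:34Z («p01's MAIN + its H-twin; MAIN stays in its tokens,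
p09 (g2) bridges in `R90S6HyperbolicHeckeFLClosed`»).  SETTING = the binder block of ★ `classOrbitalIntegral_prod_eq_smul_integral_prod_of_torus_regular_of_nonsplit` VERBATIM
(`H_v = U(Φ₂)(L⁺_v) × U(Φ₁)(L⁺_v)` at a non-split `w ∣ v`, ANY right-invariant Haar `ν_H`, CANONICAL `m_H` for a predicate `P_H` holding at the representative, `K₂ = U(Φ₂)(𝒪_v)`
(`hK2`), Haar `κ₂`, `μ_N` on `N₂ = (cmBorelTriple L 2 v).N`, `t = diag(d₀, d₁) ∈ T₂(L⁺_v)` regular with `hb`, `u ∈ U(Φ₁)(L⁺_v)`, `hK₁`) + THE HECKE DATA at `N = 2`: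
`U′₂ = U(σ_w, J₂)(L_w) = unitaryGroupOfForm σ_w ((StdForm.antidiagonal 2).over L_w)` (the socket's H-carrier), `K₀ = unitaryInt`, `N′ = unipotentU`, `hdw : UnramifiedLocalConjDatum σ_w ϖ`,
`T ∈ ℋ(U′₂, K₀)`, a frame `eH : U(Φ₂)(L⁺_v) ≃ₜ* U′₂` with the N-LAW and the K-LAW as binders (no eH-independence re-entered), `EN` any restriction of `eH` to `N₂ ≃ N′`.

* **`classOrbitalIntegral_prod_coeff_toVector_frame_eq_two`** (THE H-VALUE): with `S := {n : ↥N₂ | ↑n ∈ K₂}` (`κ₂(K₂), μ_N(S)` finite, `K₂` open — three cheap binders),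
  `classOrbitalIntegral m_H ((h₂, h₁) ↦ T[K₀](eH h₂)) ⟦(t, u)⟧ = (ν_H(K₂ × K₁) · J_H(t)).toReal • ((q^{−⟨ν,a(eH t)⟩∕2})⁻¹ · 𝒮(T)_{a(eH t)})`, `J_H(t) = χ⁻(d₀⁻¹d₁ − 1)⁻¹` the ★ token
  VERBATIM — ★ H-side canonical value ∘ ★ FILE 1 §4 at `M := 2` (the `U(Φ₁)`-factor is absorbed by ★ B-p18's `K₁`-average; the auxiliary volumes cancel by ★ FILE 2 §2).
Cell `hodgecm-mathlib`, crux H413 (`stmt-HodgeConjecture-24833`), route of record `HCCMUnconditional`; programme R90-TF (brief `director/R90-BRIEF.v2.md` 1f40d54518340a35),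
section S6 (base `R90-C14`), seat R90-C14-p01 (g2).  Lane `--kind proof --supports stmt-HodgeConjecture-24833 --as helper`; THEOREMS ONLY (no definition, no instance, no notation,
no named fact, no kit, no `sorry`); imports ★ FILE 1 + ★ FILE 2 + ★ `UnitaryGroupTorusOrbitalIntegralCanonicalH` + HarnessLib; never `Lines/`.
HONEST LABEL: measure bookkeeping, count-neutral until (B2d) `R90S6HyperbolicHeckeFL(Closed)` consumes it; proves no printed global statement, discharges no citation; HC_CM is proved
only modulo the 7 printed citations (2 remaining named inputs: hLiu418 = stmt-HodgeConjecture-24832, h413 = stmt-HodgeConjecture-24833) until rung 0 closes.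

## References
* [Rogawski1990] J. D. Rogawski, *Automorphic Representations of Unitary Groups in Three Variables*, Ann. of Math. Stud. 123 (1990): §4.9 (4.9.2) p. 55, Lemma 4.9.2 pp. 55–56;
  §4.13 p. 70; §4.3 (4.3.1) p. 43.
* [CartierCorvallis1979] P. Cartier, *Representations of 𝔭-adic groups: a survey*, PSPM 33.1 (1979): §IV (4.2) p. 146.
* [Gelbart1975] S. Gelbart, *Automorphic Forms on Adele Groups*, Ann. of Math. Stud. 83 (1975): Thm. 9.22 (iii).
-/

set_option autoImplicit false
-- the mandated namespace repeats the single-problem summit's segment (`HodgeConjecture.HodgeConjecture`)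
set_option linter.dupNamespace false

noncomputable section

open MeasureTheory Measure Set Function NumberField IsDedekindDomain
open scoped ENNReal NNReal Pointwise Valued WithZero Matrix MatrixGroups
open MulAction
open Literature.MeasureTheory.Group
open Literature.NumberTheory.Automorphic Literature.NumberTheory.Automorphic.HermitianLattice Literature.NumberTheory.Automorphic.heckeAlgebra
  Literature.NumberTheory.Automorphic.UnitaryGroup Literature.NumberTheory.Automorphic.HermitianLattice.UnramifiedLocalConjDatum
  Literature.NumberTheory.Automorphic.UnitaryGroup.HeisRing Literature.NumberTheory.Automorphic.UnitaryGroup.LineRing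
open Literature.NumberTheory.Rogawski1990 (IsRegularElt)

namespace Summit.HodgeConjecture.HodgeConjecture.R90.S6

set_option maxHeartbeats 1600000 in
-- instance-term unification on the two spellings of the CM local carrier `U(Φ₂)(L⁺_v)` — the SAME budget and reason as ★
-- `classOrbitalIntegral_eq_smul_integral_prod_of_torus_regular` (`UnitaryGroupTorusOrbitalIntegralCanonical`) and ★ `F0P3CMBorelIwahoriDatum` (precedent rule, dealer 01:35:34Z)
/-- **CARD B2a, THE H-TWIN — THE CANONICAL ORBITAL INTEGRAL OF A HECKE OPERATOR OF `U(2)_w` ON `H_v = U(Φ₂)(L⁺_v) × U(Φ₁)(L⁺_v)` AT A REGULAR LEVI CLASS, THROUGH A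
BOREL-COMPATIBLE FRAME.**  In the setting of ★ `classOrbitalIntegral_prod_eq_smul_integral_prod_of_torus_regular_of_nonsplit` (binders VERBATIM) let `eH : U(Φ₂)(L⁺_v) ≃ₜ* U′₂`
be a frame with the N-LAW `hN` and the K-LAW `hEK`, `EN` any restriction of it to `N₂ ≃ N′`, `hdw` the unramified datum at `w`, `T ∈ ℋ(U′₂, K₀)`.  Then
`classOrbitalIntegral m_H ((h₂, h₁) ↦ T[K₀](eH h₂)) ⟦(t, u)⟧ = (ν_H(K₂ × K₁) · J_H(t)).toReal • ((q^{−⟨ν,a(eH t)⟩∕2})⁻¹ · 𝒮(T)_{a(eH t)})` — Rogawski (4.9.2) on the endoscopic side,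
`J_H(t) = χ⁻(d₀⁻¹d₁ − 1)⁻¹` (`= (√‖d₀⁻¹d₁ − 1‖)⁻¹`, ★ `twistModule_cmLocal_two_eq`); the auxiliary volumes `κ₂(K₂)`, `μ_N(N₂ ∩ K₂)` cancel.
[cite: Rogawski1990, §4.9 (4.9.2) p. 55; §4.13 p. 70; §4.3 (4.3.1) p. 43] [cite: CartierCorvallis1979, §IV (4.2) p. 146] [cite: Gelbart1975, Thm. 9.22 (iii)] -/
theorem classOrbitalIntegral_prod_coeff_toVector_frame_eq_two
    (L : Type) [Field L] [NumberField L] [IsCMField L] {v : HeightOneSpectrum (𝓞 ↥(maximalRealSubfield L))}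
    (w : PlacesOver L v) (hw : IsCMField.complexConj L • w.1 = w.1)
    [MeasurableSpace ((cmDatum L 2 (Matrix.of fun i j : Fin 2 => if i.val + j.val + 1 = 2 then (1 : L) else 0)).Local v × (cmDatum L 1 (Matrix.of fun i j : Fin 1 => if i.val + j.val + 1 = 1 then (1 : L) else 0)).Local v)] [BorelSpace ((cmDatum L 2 (Matrix.of fun i j : Fin 2 => if i.val + j.val + 1 = 2 then (1 : L) else 0)).Local v × (cmDatum L 1 (Matrix.of fun i j : Fin 1 => if i.val + j.val + 1 = 1 then (1 : L) else 0)).Local v)]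
    [∀ a : ((cmDatum L 2 (Matrix.of fun i j : Fin 2 => if i.val + j.val + 1 = 2 then (1 : L) else 0)).Local v × (cmDatum L 1 (Matrix.of fun i j : Fin 1 => if i.val + j.val + 1 = 1 then (1 : L) else 0)).Local v), MeasurableSpace (((cmDatum L 2 (Matrix.of fun i j : Fin 2 => if i.val + j.val + 1 = 2 then (1 : L) else 0)).Local v × (cmDatum L 1 (Matrix.of fun i j : Fin 1 => if i.val + j.val + 1 = 1 then (1 : L) else 0)).Local v) ⧸ Subgroup.centralizer ({a} : Set ((cmDatum L 2 (Matrix.of fun i j : Fin 2 => if i.val + j.val + 1 = 2 then (1 : L) else 0)).Local v × (cmDatum L 1 (Matrix.of fun i j : Fin 1 => if i.val + j.val + 1 = 1 then (1 : L) else 0)).Local v)))]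
    [∀ a : ((cmDatum L 2 (Matrix.of fun i j : Fin 2 => if i.val + j.val + 1 = 2 then (1 : L) else 0)).Local v × (cmDatum L 1 (Matrix.of fun i j : Fin 1 => if i.val + j.val + 1 = 1 then (1 : L) else 0)).Local v), BorelSpace (((cmDatum L 2 (Matrix.of fun i j : Fin 2 => if i.val + j.val + 1 = 2 then (1 : L) else 0)).Local v × (cmDatum L 1 (Matrix.of fun i j : Fin 1 => if i.val + j.val + 1 = 1 then (1 : L) else 0)).Local v) ⧸ Subgroup.centralizer ({a} : Set ((cmDatum L 2 (Matrix.of fun i j : Fin 2 => if i.val + j.val + 1 = 2 then (1 : L) else 0)).Local v × (cmDatum L 1 (Matrix.of fun i j : Fin 1 => if i.val + j.val + 1 = 1 then (1 : L) else 0)).Local v)))]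
    (νH : Measure ((cmDatum L 2 (Matrix.of fun i j : Fin 2 => if i.val + j.val + 1 = 2 then (1 : L) else 0)).Local v × (cmDatum L 1 (Matrix.of fun i j : Fin 1 => if i.val + j.val + 1 = 1 then (1 : L) else 0)).Local v)) [νH.IsHaarMeasure] [νH.IsMulRightInvariant]
    {P_H : ((cmDatum L 2 (Matrix.of fun i j : Fin 2 => if i.val + j.val + 1 = 2 then (1 : L) else 0)).Local v × (cmDatum L 1 (Matrix.of fun i j : Fin 1 => if i.val + j.val + 1 = 1 then (1 : L) else 0)).Local v) → Prop} {mH : OrbitalMeasureFamily ((cmDatum L 2 (Matrix.of fun i j : Fin 2 => if i.val + j.val + 1 = 2 then (1 : L) else 0)).Local v × (cmDatum L 1 (Matrix.of fun i j : Fin 1 => if i.val + j.val + 1 = 1 then (1 : L) else 0)).Local v)} (hmH : mH.IsCanonical P_H νH)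
    [MeasurableSpace ↥(unitaryGroupOfForm (conjLocal L (IsCMField.complexConj L) v) (cmLocalForm L 2 v))] [BorelSpace ↥(unitaryGroupOfForm (conjLocal L (IsCMField.complexConj L) v) (cmLocalForm L 2 v))]
    (K₂ : Subgroup ↥(unitaryGroupOfForm (conjLocal L (IsCMField.complexConj L) v) (cmLocalForm L 2 v))) (hK2 : K₂ = cmLocalIntegralLevel L 2 (Matrix.of fun i j : Fin 2 => if i.val + j.val + 1 = 2 then (1 : L) else 0) v)
    (hKo : IsOpen (K₂ : Set ↥(unitaryGroupOfForm (conjLocal L (IsCMField.complexConj L) v) (cmLocalForm L 2 v))))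
    (κ₂ : Measure ↥K₂) [κ₂.IsHaarMeasure] [SFinite κ₂] (hκ : κ₂ Set.univ ≠ ∞)
    (μN₂ : Measure ↥(cmBorelTriple L 2 v).N) [μN₂.IsHaarMeasure] [SFinite μN₂]
    (hμ : μN₂ {n | (n : ↥(unitaryGroupOfForm (conjLocal L (IsCMField.complexConj L) v) (cmLocalForm L 2 v))) ∈ K₂} ≠ ∞)
    (t : ↥(cmBorelTriple L 2 v).M) {d : Fin 2 → (LocalRing L v)ˣ}
    (hd : glDiagonal 2 (LocalRing L v) d = ((t : ↥(unitaryGroupOfForm (conjLocal L (IsCMField.complexConj L) v) (cmLocalForm L 2 v))) : GL (Fin 2) (LocalRing L v)))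
    (hb : IsUnit ((((d 0)⁻¹ * d 1 : (LocalRing L v)ˣ) : LocalRing L v) - 1))
    (hreg₂ : IsRegularElt ((t : ↥(unitaryGroupOfForm (conjLocal L (IsCMField.complexConj L) v) (cmLocalForm L 2 v))) : GL (Fin 2) (LocalRing L v)))
    (u : (cmDatum L 1 (Matrix.of fun i j : Fin 1 => if i.val + j.val + 1 = 1 then (1 : L) else 0)).Local v) (hPH : P_H (Quotient.out (ConjClasses.mk (((t : ↥(unitaryGroupOfForm (conjLocal L (IsCMField.complexConj L) v) (cmLocalForm L 2 v))) : (cmDatum L 2 (Matrix.of fun i j : Fin 2 => if i.val + j.val + 1 = 2 then (1 : L) else 0)).Local v), u))))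
    (hK₁ : ∀ x : (cmDatum L 1 (Matrix.of fun i j : Fin 1 => if i.val + j.val + 1 = 1 then (1 : L) else 0)).Local v, x ∈ cmLocalIntegralLevel L 1 (Matrix.of fun i j : Fin 1 => if i.val + j.val + 1 = 1 then (1 : L) else 0) v)
    -- the Hecke side at `N = 2`: the socket's H-carrier at `w`, the unramified datum, the frame `eH` with its laws
    [MeasurableSpace ↥(unitaryGroupOfForm (galAdicCompletionMap (L := L) (IsCMField.complexConj L) hw) ((StdForm.antidiagonal 2).over (w.1.adicCompletion L)))] [BorelSpace ↥(unitaryGroupOfForm (galAdicCompletionMap (L := L) (IsCMField.complexConj L) hw) ((StdForm.antidiagonal 2).over (w.1.adicCompletion L)))]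
    [Finite 𝓀[w.1.adicCompletion L]] {ϖ : w.1.adicCompletion L}
    (hdw : UnramifiedLocalConjDatum (galAdicCompletionMap (L := L) (IsCMField.complexConj L) hw) ϖ)
    (eH : (cmDatum L 2 (Matrix.of fun i j : Fin 2 => if i.val + j.val + 1 = 2 then (1 : L) else 0)).Local v ≃ₜ* ↥(unitaryGroupOfForm (galAdicCompletionMap (L := L) (IsCMField.complexConj L) hw) ((StdForm.antidiagonal 2).over (w.1.adicCompletion L))))
    (hN : ∀ g : ↥(unitaryGroupOfForm (conjLocal L (IsCMField.complexConj L) v) (cmLocalForm L 2 v)), g ∈ (cmBorelTriple L 2 v).N ↔ eH g ∈ unipotentU (galAdicCompletionMap (L := L) (IsCMField.complexConj L) hw) ((StdForm.antidiagonal 2).over (w.1.adicCompletion L)))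
    (hEK : ∀ g : ↥(unitaryGroupOfForm (conjLocal L (IsCMField.complexConj L) v) (cmLocalForm L 2 v)), eH g ∈ unitaryInt (galAdicCompletionMap (L := L) (IsCMField.complexConj L) hw) ((StdForm.antidiagonal 2).over (w.1.adicCompletion L)) ↔ g ∈ K₂)
    (EN : ↥(cmBorelTriple L 2 v).N ≃ₜ* ↥(unipotentU (galAdicCompletionMap (L := L) (IsCMField.complexConj L) hw) ((StdForm.antidiagonal 2).over (w.1.adicCompletion L))))
    (hEN : ∀ n : ↥(cmBorelTriple L 2 v).N, ((EN n : ↥(unipotentU (galAdicCompletionMap (L := L) (IsCMField.complexConj L) hw) ((StdForm.antidiagonal 2).over (w.1.adicCompletion L)))) : ↥(unitaryGroupOfForm (galAdicCompletionMap (L := L) (IsCMField.complexConj L) hw) ((StdForm.antidiagonal 2).over (w.1.adicCompletion L)))) = eH (n : ↥(unitaryGroupOfForm (conjLocal L (IsCMField.complexConj L) v) (cmLocalForm L 2 v))))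
    (T : heckeAlgebra ℂ ↥(unitaryGroupOfForm (galAdicCompletionMap (L := L) (IsCMField.complexConj L) hw) ((StdForm.antidiagonal 2).over (w.1.adicCompletion L))) (unitaryInt (galAdicCompletionMap (L := L) (IsCMField.complexConj L) hw) ((StdForm.antidiagonal 2).over (w.1.adicCompletion L)))) :
    classOrbitalIntegral mH
        (fun h : ((cmDatum L 2 (Matrix.of fun i j : Fin 2 => if i.val + j.val + 1 = 2 then (1 : L) else 0)).Local v × (cmDatum L 1 (Matrix.of fun i j : Fin 1 => if i.val + j.val + 1 = 1 then (1 : L) else 0)).Local v) => (toVector (unitaryInt (galAdicCompletionMap (L := L) (IsCMField.complexConj L) hw) ((StdForm.antidiagonal 2).over (w.1.adicCompletion L))) T).coeff ((eH h.1 : ↥(unitaryGroupOfForm (galAdicCompletionMap (L := L) (IsCMField.complexConj L) hw) ((StdForm.antidiagonal 2).over (w.1.adicCompletion L)))) : ↥(unitaryGroupOfForm (galAdicCompletionMap (L := L) (IsCMField.complexConj L) hw) ((StdForm.antidiagonal 2).over (w.1.adicCompletion L))) ⧸ unitaryInt (galAdicCompletionMap (L := L) (IsCMField.complexConj L) hw)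 ((StdForm.antidiagonal 2).over (w.1.adicCompletion L))))
        (ConjClasses.mk (((t : ↥(unitaryGroupOfForm (conjLocal L (IsCMField.complexConj L) v) (cmLocalForm L 2 v))) : (cmDatum L 2 (Matrix.of fun i j : Fin 2 => if i.val + j.val + 1 = 2 then (1 : L) else 0)).Local v), u)) =
      ((νH ((((cmLocalIntegralLevel L 2 (Matrix.of fun i j : Fin 2 => if i.val + j.val + 1 = 2 then (1 : L) else 0) v).prod (cmLocalIntegralLevel L 1 (Matrix.of fun i j : Fin 1 => if i.val + j.val + 1 = 1 then (1 : L) else 0) v)) : Subgroup ((cmDatum L 2 (Matrix.of fun i j : Fin 2 => if i.val + j.val + 1 = 2 then (1 : L) else 0)).Local v × (cmDatum L 1 (Matrix.of fun i j : Fin 1 => if i.val + j.val + 1 = 1 then (1 : L) else 0)).Local v)) : Set ((cmDatum L 2 (Matrix.of fun i j : Fin 2 => if i.val + j.val + 1 = 2 then (1 : L) else 0)).Local v × (cmDatum L 1 (Matrix.of fun i j : Fin 1 => if i.val + j.val + 1 = 1 then (1 : L) else 0)).Local v)) * ((letI : MeasurableSpace (LocalRing L v) := borel _; haveI : BorelSpace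 (LocalRing L v) := ⟨rfl⟩
          haveI : SecondCountableTopology (LocalRing L v) := secondCountableTopology_localRing (E := L) v
          ((skewModulus (conjLocal L (IsCMField.complexConj L) v) (continuous_conjLocal L (IsCMField.complexConj L) v) hb.unit
            (map_unit_torusScalar_sub_one_two (conjLocal L (IsCMField.complexConj L) v) (cmLocalForm_eq_over L 2 v)
              (⟨(t : ↥(unitaryGroupOfForm (conjLocal L (IsCMField.complexConj L) v) (cmLocalForm L 2 v))), t.2⟩ : ↥(torusU (conjLocal L (IsCMField.complexConj L) v) (cmLocalForm L 2 v))) hd hb))⁻¹ : ℝ≥0)) : ℝ≥0∞))).toReal •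
        ((satakeWeight (residueCardSqrt (w.1.adicCompletion L)) (hdw.iwasawaExp (eH ((t : ↥(unitaryGroupOfForm (conjLocal L (IsCMField.complexConj L) v) (cmLocalForm L 2 v))) : (cmDatum L 2 (Matrix.of fun i j : Fin 2 => if i.val + j.val + 1 = 2 then (1 : L) else 0)).Local v))))⁻¹ *
          (hdw.satakeTransform T).coeff (hdw.iwasawaExp (eH ((t : ↥(unitaryGroupOfForm (conjLocal L (IsCMField.complexConj L) v) (cmLocalForm L 2 v))) : (cmDatum L 2 (Matrix.of fun i j : Fin 2 => if i.val + j.val + 1 = 2 then (1 : L) else 0)).Local v)))) := by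
  have hK₀ : IsOpen (unitaryInt (galAdicCompletionMap (L := L) (IsCMField.complexConj L) hw) ((StdForm.antidiagonal 2).over (w.1.adicCompletion L)) : Set ↥(unitaryGroupOfForm (galAdicCompletionMap (L := L) (IsCMField.complexConj L) hw) ((StdForm.antidiagonal 2).over (w.1.adicCompletion L)))) := isOpen_unitaryInt _ _
  have hφ : Measurable fun h : ((cmDatum L 2 (Matrix.of fun i j : Fin 2 => if i.val + j.val + 1 = 2 then (1 : L) else 0)).Local v × (cmDatum L 1 (Matrix.of fun i j : Fin 1 => if i.val + j.val + 1 = 1 then (1 : L) else 0)).Local v) => (toVector (unitaryInt (galAdicCompletionMap (L := L) (IsCMField.complexConj L) hw) ((StdForm.antidiagonal 2).over (w.1.adicCompletion L))) T).coeff ((eH h.1 : ↥(unitaryGroupOfForm (galAdicCompletionMap (L := L) (IsCMField.complexConj L) hw) ((StdForm.antidiagonal 2).over (w.1.adicCompletion L)))) : ↥(unitaryGroupOfForm (galAdicCompletionMap (L := L) (IsCMField.complexConj L) hw) ((StdForm.antidiagonal 2).over (w.1.adicCompletion L))) ⧸ unitaryInt (galAdicCompletionMap (L := L) (IsCMField.complexConj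 L) hw) ((StdForm.antidiagonal 2).over (w.1.adicCompletion L))) :=
    measurable_coeff_toVector_comp _ hK₀ T (eG := fun h : ((cmDatum L 2 (Matrix.of fun i j : Fin 2 => if i.val + j.val + 1 = 2 then (1 : L) else 0)).Local v × (cmDatum L 1 (Matrix.of fun i j : Fin 1 => if i.val + j.val + 1 = 1 then (1 : L) else 0)).Local v) => eH h.1) (eH.continuous.comp continuous_fst)
  -- ★ the canonical H-side value at `⟦(t, u)⟧` as the `K₂ × N₂` integral
  refine (classOrbitalIntegral_prod_eq_smul_integral_prod_of_torus_regular_of_nonsplit L w hw νH hmH K₂ hK2 κ₂ μN₂ t hd hb hreg₂ u hPH hK₁ _ hφ).trans ?_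
  -- ★ FILE 1 §4 at `M := 2` through `eH` re-typed on the `unitaryGroupOfForm` spelling of `U(Φ₂)(L⁺_v)` (★ `cmDatum_Local_eq`, `rfl`)
  have ht : (t : ↥(unitaryGroupOfForm (conjLocal L (IsCMField.complexConj L) v) (cmLocalForm L 2 v))) ∈ Subgroup.normalizer ((cmBorelTriple L 2 v).N : Set ↥(unitaryGroupOfForm (conjLocal L (IsCMField.complexConj L) v) (cmLocalForm L 2 v))) := (cmBorelTriple L 2 v).le_normalizer ((cmBorelTriple L 2 v).M_le t.2)
  obtain ⟨E, hE⟩ : ∃ E : ↥(unitaryGroupOfForm (conjLocal L (IsCMField.complexConj L) v) (cmLocalForm L 2 v)) ≃ₜ* ↥(unitaryGroupOfForm (galAdicCompletionMap (L := L) (IsCMField.complexConj L) hw) ((StdForm.antidiagonal 2).over (w.1.adicCompletion L))), ∀ g, E g = eH g := ⟨eH, fun _ => rfl⟩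
  have hN' : ∀ g : ↥(unitaryGroupOfForm (conjLocal L (IsCMField.complexConj L) v) (cmLocalForm L 2 v)), g ∈ (cmBorelTriple L 2 v).N ↔ E g ∈ unipotentU (galAdicCompletionMap (L := L) (IsCMField.complexConj L) hw) ((StdForm.antidiagonal 2).over (w.1.adicCompletion L)) := fun g => (hN g).trans (by rw [hE])
  have hEK' : ∀ g : ↥(unitaryGroupOfForm (conjLocal L (IsCMField.complexConj L) v) (cmLocalForm L 2 v)), E g ∈ unitaryInt (galAdicCompletionMap (L := L) (IsCMField.complexConj L) hw) ((StdForm.antidiagonal 2).over (w.1.adicCompletion L)) ↔ g ∈ K₂ := fun g => (show _ ↔ _ by rw [hE]).trans (hEK g)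
  have hEN' : ∀ n : ↥(cmBorelTriple L 2 v).N, ((EN n : ↥(unipotentU (galAdicCompletionMap (L := L) (IsCMField.complexConj L) hw) ((StdForm.antidiagonal 2).over (w.1.adicCompletion L)))) : ↥(unitaryGroupOfForm (galAdicCompletionMap (L := L) (IsCMField.complexConj L) hw) ((StdForm.antidiagonal 2).over (w.1.adicCompletion L)))) = E n := fun n => (hEN n).trans (hE n).symm
  have hI := integral_prod_coeff_toVector_frame_eq E hN' hEK' EN hEN' μN₂ κ₂ hdw T ht hμ
  simp only [hE] at hI
  simp only [hI]
  -- the auxiliary volumes cancel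
  have hκ0 : κ₂ Set.univ ≠ 0 := IsOpenPosMeasure.open_pos _ isOpen_univ Set.univ_nonempty
  have hμ0 : μN₂ {n | (n : ↥(unitaryGroupOfForm (conjLocal L (IsCMField.complexConj L) v) (cmLocalForm L 2 v))) ∈ K₂} ≠ 0 :=
    IsOpenPosMeasure.open_pos _ (hKo.preimage continuous_subtype_val) ⟨1, (K₂.one_mem : ((1 : ↥(cmBorelTriple L 2 v).N) : ↥(unitaryGroupOfForm (conjLocal L (IsCMField.complexConj L) v) (cmLocalForm L 2 v))) ∈ K₂)⟩
  exact toReal_div_mul_mul_smul_eq hκ0 hκ hμ0 hμ _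

end Summit.HodgeConjecture.HodgeConjecture.R90.S6

end
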